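import Literature.Geometry.Lorentzian.LeviCivitaProofs
import Literature.Geometry.Lorentzian.CoordinateFrames
import Literature.Geometry.Lorentzian.CurvatureRegularity
import HarnessLib

/-!
# The Laplace–Beltrami operator and the inverse metric of an abstract metric in a chart:
# `□_g f = gⁱʲ (∂ᵢ∂ⱼ f̂ − Γˡᵢⱼ ∂ₗ f̂)`, `g⁻¹(du, dv) = gⁱʲ ∂ᵢû ∂ⱼv̂`

For a smooth pseudo-Riemannian metric `g` on a manifold `M` (boundaryless model `I` on `E`), a
point `x₀`, its extended chart `φ = extChartAt I x₀` and a basis `b` of `E`, the **coordinate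
frame** `∂ᵢ = sᵢ` is Mathlib's local frame of `TM` induced by the trivialization at `x₀`
(`(trivializationAt E (TangentSpace I) x₀).localFrame b i`; on the chart domain
`sᵢ(p) = D(φ⁻¹)(φ p) bᵢ`, `localFrame_apply_eq_mfderivWithin_symm`; its brackets vanish,
`CoordinateFrames.lean`). This file computes the tree's abstract second-order objects of
`LeviCivita.lean` — the Hessian `g.hessian f p`, the wave/Laplace–Beltrami operator
`g.dalembertian f p = tr_g Hess f` and the inverse metric on covectors `g.innerDual` — at every
point `p` of the chart domain of `x₀`, in terms of chart representatives `f̂ = f ∘ φ⁻¹`,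
`Ĝᵢⱼ = g(∂ᵢ, ∂ⱼ) ∘ φ⁻¹` and their ordinary (Fréchet) derivatives on `E`:

* `mvfderiv_apply_localFrame` (`_of_eventuallyEq`) — `dF_p(∂ᵢ) = ∂ᵢ F̂ (φ p)`
  (O'Neill 1983, Ch. 1, Def. 1.9 ff.);
* `eq_sum_gram_inv_smul_localFrame`, `mvfderiv_apply_eq_sum_gram_inv` — `w = ∑ₗ (∑ₖ g(w,∂ₖ) Ĝᵏˡ) ∂ₗ`
  (raising an index with the inverse Gram matrix, O'Neill Ch. 3, p. 60);
* `two_mul_val_leviCivita_localFrame` — **the Christoffel symbols of the first kind**: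
  `2 g(∇_{∂ᵢ}∂ⱼ, ∂ₖ) = ∂ᵢĜ_{jk} + ∂ⱼĜ_{ki} − ∂ₖĜ_{ij}` (Koszul formula on commuting fields,
  O'Neill Ch. 3, Prop. 3.13 (1));
* `hessian_localFrame` — `Hess f(∂ᵢ, ∂ⱼ)(p) = ∂ᵢ∂ⱼ f̂ − ∑ₗ Γˡᵢⱼ ∂ₗ f̂`,
  `Γˡᵢⱼ = ∑ₖ ½(∂ᵢĜ_{jk} + ∂ⱼĜ_{ki} − ∂ₖĜ_{ij}) Ĝᵏˡ` (O'Neill Ch. 3, Lemma 3.49 with Prop. 3.13);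
* `dalembertian_eq_sum_localFrame` — **the Laplace–Beltrami operator in a chart**:
  `□_g f (p) = ∑ᵢⱼ Ĝⁱʲ (∂ᵢ∂ⱼ f̂ − ∑ₗ (∑ₖ ½(∂ᵢĜ_{jk} + ∂ⱼĜ_{ik} − ∂ₖĜ_{ij}) Ĝᵏˡ) ∂ₗ f̂)` at `φ p`
  (O'Neill Ch. 3, the display after Def. 3.50; Lee 2018, (5.29) `Δu = gⁱʲu_{;ij}`), in exactly
  the shape consumed by the divergence-form identity
  `Literature.Analysis.Calculus.coordLaplacian_mul_sqrt_det_eq_sum_fderiv`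
  (`Analysis/Calculus/CoordinateLaplacian.lean`, Lee 2018, Prop. 2.46);
* `innerDual_eq_sum_localFrame`, `innerDual_mvfderiv_eq_sum_localFrame` —
  `g⁻¹_p(du, dv) = ∑ᵢⱼ Ĝⁱʲ ∂ᵢû ∂ⱼv̂` (O'Neill Ch. 3, p. 60 and Def. 3.50);
* `continuous_dalembertian`, `continuous_innerDual_mvfderiv` — `□_g f` (`f ∈ C²`) and
  `g⁻¹(du, dv)` (`u, v ∈ C¹`) are continuous on `M`, via the coordinate expressions
  (`continuousOn_coordLaplacian`, `continuousOn_coordInnerDual`) and the smoothness of `Ĝ` on the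
  chart target (`contDiffOn_gram_comp_extChartAt_symm`).

Everything is proved; there are no definitions and no named facts. The representatives enter
through hypotheses `fh =ᶠ[𝓝 (φ p)] f ∘ φ⁻¹`, `Gh =ᶠ Ĝ` (germs at `φ p`), so that any convenient
global formula for them (e.g. `chartGramMatrix` of `Volume.lean` for a Riemannian metric on a
manifold modelled on `ℝ^m`) can be substituted. The metric is taken `C^∞` (the tree's frame
regularity lemmas `contMDiffOn_gram_localFrame` are stated for smooth metrics); `f` need only be
`C²` at the point. This is the chart-side half of Green's identity / the divergence theorem for
the Laplace–Beltrami operator on closed manifolds (assembled elsewhere with the chart formula for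
the Riemannian measure, `VolumeChartIntegral.lean`).

## References

* B. O'Neill, *Semi-Riemannian geometry with applications to relativity*, Academic Press 1983,
  Ch. 1, Def. 1.9 ff. (coordinate vector fields); Ch. 3, Thm. 3.11 (Koszul formula), Prop. 3.13
  (Christoffel symbols), Lemma 3.49 and Def. 3.50 ff. (Hessian, gradient, Laplacian in
  coordinates), pp. 60–61 (metric contraction, `g^{ij}`) (key `ONeill1983`).
* J. M. Lee, *Introduction to Riemannian Manifolds*, 2nd ed., Springer 2018, Prop. 2.46 and
  Problem 5-14, (5.28)–(5.29) (key `Lee2018`).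
-/

noncomputable section

open Bundle Set Function Filter Manifold VectorField Finset
open scoped Manifold ContDiff Topology Matrix

namespace Literature.Geometry.Lorentzian

variable {E : Type*} [NormedAddCommGroup E] [NormedSpace ℝ E] {H : Type*} [TopologicalSpace H]
  {I : ModelWithCorners ℝ E H} {M : Type*} [TopologicalSpace M] [ChartedSpace H M]
  [IsManifold I ∞ M]

/-! ### The coordinate frame of a chart and derivatives of functions along it -/

section Frame

variable {ι : Type*} (b : Module.Basis ι ℝ E) {x₀ p : M}

/-- **The coordinate frame is `D(φ⁻¹) bᵢ`.** On the chart domain of `x₀`, the `i`-th member of the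
local frame of `TM` induced by the trivialization at `x₀` and the basis `b` of the model space is
`sᵢ(p) = D(φ⁻¹)(φ p) bᵢ = ∂ᵢ|_p`, `φ = extChartAt I x₀` (Mathlib's
`TangentBundle.symmL_trivializationAt`). O'Neill 1983, Ch. 1, Def. 1.9 ff. (coordinate vector
fields). [cite: ONeill1983, Ch. 1, Def. 1.9 ff] -/
theorem localFrame_apply_eq_mfderivWithin_symm (hp : p ∈ (chartAt H x₀).source) (i : ι) :
    (trivializationAt E (TangentSpace I) x₀).localFrame b i p =
      mfderivWithin 𝓘(ℝ, E) I (extChartAt I x₀).symm (range I) (extChartAt I x₀ p) (b i) := by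
  have hpe : p ∈ (trivializationAt E (TangentSpace I) x₀).baseSet := by simpa using hp
  have h2 := DFunLike.congr_fun (TangentBundle.symmL_trivializationAt (𝕜 := ℝ) (I := I) hp) (b i)
  rw [Trivialization.symmL_apply _ hpe] at h2
  rw [Trivialization.localFrame_apply_of_mem_baseSet _ b hpe]
  have h3 : (trivializationAt E (TangentSpace I) x₀).basisAt b hpe i =
      (trivializationAt E (TangentSpace I) x₀).symm p (b i) := by
    simp [Trivialization.basisAt]
  rw [h3]
  exact h2

/-- The coordinate frame fields are `C^∞` at the points of the chart domain (Mathlib's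
`contMDiffAt_localFrame_of_mem`). [folklore] -/
theorem contMDiffAt_localFrame_chart (hp : p ∈ (chartAt H x₀).source) (i : ι) :
    CMDiffAt ∞ (T% ((trivializationAt E (TangentSpace I) x₀).localFrame b i)) p :=
  contMDiffAt_localFrame_of_mem ∞ _ b i (by simpa using hp)

/-- The coordinate frame fields are differentiable at the points of the chart domain. [folklore] -/
theorem mdifferentiableAt_localFrame_chart (hp : p ∈ (chartAt H x₀).source) (i : ι) :
    MDiffAt (T% ((trivializationAt E (TangentSpace I) x₀).localFrame b i)) p :=
  (contMDiffAt_localFrame_chart b hp i).mdifferentiableAt (by simp)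

variable [I.Boundaryless]

/-- **Differentiating along a coordinate vector is a partial derivative in the chart**: for
`F : M → ℝ` differentiable at a point `p` of the chart domain of `x₀`,
`dF_p(∂ᵢ|_p) = D(F ∘ φ⁻¹)(φ p) bᵢ` (chain rule; boundaryless model, so that `φ.target` is open
and `mfderivWithin … (range I) = fderiv`). O'Neill 1983, Ch. 1, Def. 1.9 ff. (`∂ᵢ f = ∂(f ∘ ξ⁻¹)/∂uⁱ`).
[cite: ONeill1983, Ch. 1, Def. 1.9 ff] -/
theorem mvfderiv_apply_mfderivWithin_symm {F : M → ℝ} (hp : p ∈ (chartAt H x₀).source)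
    (hF : MDifferentiableAt I 𝓘(ℝ, ℝ) F p) (v : E) :
    mvfderiv I F p (mfderivWithin 𝓘(ℝ, E) I (extChartAt I x₀).symm (range I)
        (extChartAt I x₀ p) v) =
      fderiv ℝ (F ∘ (extChartAt I x₀).symm) (extChartAt I x₀ p) v := by
  have hps : p ∈ (extChartAt I x₀).source := by simpa [extChartAt_source] using hp
  have hz : extChartAt I x₀ p ∈ (extChartAt I x₀).target := (extChartAt I x₀).map_source hps
  have hpp : (extChartAt I x₀).symm (extChartAt I x₀ p) = p := (extChartAt I x₀).left_inv hps
  have hsymm : MDifferentiableWithinAt 𝓘(ℝ, E) I (extChartAt I x₀).symm (range I)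
      (extChartAt I x₀ p) :=
    mdifferentiableWithinAt_extChartAt_symm hz
  have hF' : MDifferentiableAt I 𝓘(ℝ, ℝ) F ((extChartAt I x₀).symm (extChartAt I x₀ p)) := by
    rwa [hpp]
  have hcomp := mfderiv_comp_mfderivWithin (extChartAt I x₀ p) hF' hsymm
    (by rw [ModelWithCorners.Boundaryless.range_eq_univ]; exact uniqueMDiffWithinAt_univ _)
  rw [mfderivWithin_eq_fderivWithin, ModelWithCorners.Boundaryless.range_eq_univ,
    fderivWithin_univ] at hcomp
  rw [ModelWithCorners.Boundaryless.range_eq_univ, hcomp, hpp]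
  rfl

/-- **Partial derivatives in a chart**: for `F : M → ℝ` differentiable at a point `p` of the chart
domain of `x₀`, `dF_p(∂ᵢ|_p) = D(F ∘ φ⁻¹)(φ p) bᵢ`, `∂ᵢ` the coordinate frame of the chart.
O'Neill 1983, Ch. 1, Def. 1.9 ff. [cite: ONeill1983, Ch. 1, Def. 1.9 ff] -/
theorem mvfderiv_apply_localFrame {F : M → ℝ} (hp : p ∈ (chartAt H x₀).source)
    (hF : MDifferentiableAt I 𝓘(ℝ, ℝ) F p) (i : ι) :
    mvfderiv I F p ((trivializationAt E (TangentSpace I) x₀).localFrame b i p) =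
      fderiv ℝ (F ∘ (extChartAt I x₀).symm) (extChartAt I x₀ p) (b i) := by
  rw [localFrame_apply_eq_mfderivWithin_symm b hp, mvfderiv_apply_mfderivWithin_symm hp hF]

/-- **Partial derivatives in a chart, with a representative**: if `Fh` agrees with `F ∘ φ⁻¹` near
`φ p`, then `dF_p(∂ᵢ|_p) = D Fh (φ p) bᵢ`. [cite: ONeill1983, Ch. 1, Def. 1.9 ff] -/
theorem mvfderiv_apply_localFrame_of_eventuallyEq {F : M → ℝ} {Fh : E → ℝ}
    (hp : p ∈ (chartAt H x₀).source) (hF : MDifferentiableAt I 𝓘(ℝ, ℝ) F p)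
    (hFh : Fh =ᶠ[𝓝 (extChartAt I x₀ p)] F ∘ (extChartAt I x₀).symm) (i : ι) :
    mvfderiv I F p ((trivializationAt E (TangentSpace I) x₀).localFrame b i p) =
      fderiv ℝ Fh (extChartAt I x₀ p) (b i) := by
  rw [mvfderiv_apply_localFrame b hp hF, hFh.fderiv_eq]

end Frame

/-! ### Expansion in the coordinate frame and the Koszul formula on coordinate fields -/

section Metric

variable [FiniteDimensional ℝ E] {n : ℕ∞ω}
  (g : PseudoRiemannianMetric I n E (TangentSpace I : M → Type _))
  {ι : Type*} [Fintype ι] [DecidableEq ι] (b : Module.Basis ι ℝ E) {x₀ p : M}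

omit [FiniteDimensional ℝ E] in
/-- **Expansion of a tangent vector in the coordinate frame through the metric**: for `p` in the
chart domain of `x₀`, with `sₗ = ∂ₗ|_p` the coordinate frame and `𝒢ᵢⱼ = g_p(sᵢ, sⱼ)` its
(invertible) Gram matrix, every `w ∈ T_p M` is `w = ∑ₗ (∑ₖ g_p(w, sₖ) (𝒢⁻¹)ₖₗ) sₗ` — i.e.
`wˡ = gˡᵏ w_k`, raising the index of the covector `g(w, ·)` (O'Neill 1983, Ch. 3, p. 60:
metrically equivalent vectors and covectors; proof: if `w = ∑ cˡ sₗ` then `g(w, sₖ) = ∑ cˡ 𝒢ₗₖ`,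
a linear system with matrix `𝒢`). [cite: ONeill1983, Ch. 3, p. 60] -/
theorem eq_sum_gram_inv_smul_localFrame (hp : p ∈ (chartAt H x₀).source)
    (w : TangentSpace I p) :
    w = ∑ l, (∑ k, g.val p w ((trivializationAt E (TangentSpace I) x₀).localFrame b k p) *
      (Matrix.of fun i j ↦ g.val p ((trivializationAt E (TangentSpace I) x₀).localFrame b i p)
        ((trivializationAt E (TangentSpace I) x₀).localFrame b j p))⁻¹ k l) •
      (trivializationAt E (TangentSpace I) x₀).localFrame b l p := by
  have hpe : p ∈ (trivializationAt E (TangentSpace I) x₀).baseSet := by simpa using hp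
  set β : Module.Basis ι ℝ (TangentSpace I p) := (trivializationAt E (TangentSpace I) x₀).basisAt b hpe
    with hβ_def
  have hβ : ∀ l, (trivializationAt E (TangentSpace I) x₀).localFrame b l p = β l := fun l ↦
    Trivialization.localFrame_apply_of_mem_baseSet _ b hpe
  simp only [hβ]
  set 𝒢 : Matrix ι ι ℝ := Matrix.of fun i j ↦ g.val p (β i) (β j) with h𝒢
  have h𝒢u : IsUnit 𝒢.det := isUnit_iff_ne_zero.2 (det_gram_ne_zero g p β)
  set c : ι → ℝ := fun l ↦ β.repr w l with hc
  have hw : w = ∑ l, c l • β l := by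
    conv_lhs => rw [← β.sum_repr w]
  set u : ι → ℝ := fun k ↦ g.val p w (β k) with hu_def
  have hu : u = c ᵥ* 𝒢 := by
    ext k
    simp only [hu_def, Matrix.vecMul, dotProduct, h𝒢, Matrix.of_apply]
    conv_lhs => rw [hw]
    simp only [map_sum, map_smul, FunLike.coe_sum, Finset.sum_apply, FunLike.coe_smul,
      Pi.smul_apply, smul_eq_mul]
  have hcu : c = u ᵥ* 𝒢⁻¹ := by
    rw [hu, Matrix.vecMul_vecMul, Matrix.mul_nonsing_inv _ h𝒢u, Matrix.vecMul_one]
  conv_lhs => rw [hw]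
  refine Finset.sum_congr rfl (fun l _ ↦ ?_)
  congr 1
  have h := congr_fun hcu l
  simp only [Matrix.vecMul, dotProduct, hu_def] at h
  exact h

omit [FiniteDimensional ℝ E] in
/-- **Differentiating a function along any tangent vector, in the coordinate frame**:
`dF_p(w) = ∑ₗ (∑ₖ g_p(w, sₖ) (𝒢⁻¹)ₖₗ) dF_p(sₗ)` (linearity of `dF_p` and
`eq_sum_gram_inv_smul_localFrame`). [cite: ONeill1983, Ch. 3, p. 60] -/
theorem mvfderiv_apply_eq_sum_gram_inv (hp : p ∈ (chartAt H x₀).source) (F : M → ℝ)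
    (w : TangentSpace I p) :
    mvfderiv I F p w = ∑ l, (∑ k, g.val p w ((trivializationAt E (TangentSpace I) x₀).localFrame b k p) *
      (Matrix.of fun i j ↦ g.val p ((trivializationAt E (TangentSpace I) x₀).localFrame b i p)
        ((trivializationAt E (TangentSpace I) x₀).localFrame b j p))⁻¹ k l) *
      mvfderiv I F p ((trivializationAt E (TangentSpace I) x₀).localFrame b l p) := by
  conv_lhs => rw [eq_sum_gram_inv_smul_localFrame g b hp w]
  simp only [map_sum, map_smul, smul_eq_mul]

end Metric

section Koszul

variable [FiniteDimensional ℝ E] [CompleteSpace E] [I.Boundaryless]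
  (g : PseudoRiemannianMetric I ∞ E (TangentSpace I : M → Type _)) [g.HasLeviCivita]
  {ι : Type*} (b : Module.Basis ι ℝ E) {x₀ p : M}

/-- **The Koszul formula on coordinate vector fields: Christoffel symbols of the first kind.**
For `p` in the chart domain of `x₀`, coordinate frame `sᵢ = ∂ᵢ` and a chart representative `Gh`
of the metric coefficients near `φ p` (`Gh z i j = g(sᵢ, sⱼ)(φ⁻¹ z)`),
`2 g_p(∇_{∂ᵢ} ∂ⱼ, ∂ₖ) = ∂ᵢ g_{jk} + ∂ⱼ g_{ki} − ∂ₖ g_{ij}` at `φ p` (all brackets `[∂ᵢ, ∂ⱼ]` vanish).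
O'Neill 1983, Ch. 3, Prop. 3.13 (1) and its proof (`2⟨D_{∂ᵢ}∂ⱼ, ∂ₖ⟩ = ∂ᵢg_{jk} + ∂ⱼg_{ik} − ∂ₖg_{ij}`,
from the Koszul formula Thm. 3.11). [cite: ONeill1983, Ch. 3, Prop. 3.13] -/
theorem two_mul_val_leviCivita_localFrame (hp : p ∈ (chartAt H x₀).source) {Gh : E → ι → ι → ℝ}
    (hGh : ∀ᶠ z in 𝓝 (extChartAt I x₀ p), ∀ i j, Gh z i j =
      g.val ((extChartAt I x₀).symm z)
        ((trivializationAt E (TangentSpace I) x₀).localFrame b i ((extChartAt I x₀).symm z))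
        ((trivializationAt E (TangentSpace I) x₀).localFrame b j ((extChartAt I x₀).symm z)))
    (i j k : ι) :
    2 * g.val p (g.leviCivita ((trivializationAt E (TangentSpace I) x₀).localFrame b j) p
        ((trivializationAt E (TangentSpace I) x₀).localFrame b i p))
      ((trivializationAt E (TangentSpace I) x₀).localFrame b k p) =
      fderiv ℝ (fun z ↦ Gh z j k) (extChartAt I x₀ p) (b i) +
        fderiv ℝ (fun z ↦ Gh z k i) (extChartAt I x₀ p) (b j) -
        fderiv ℝ (fun z ↦ Gh z i j) (extChartAt I x₀ p) (b k) := by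
  have hpe : p ∈ (trivializationAt E (TangentSpace I) x₀).baseSet := by simpa using hp
  have hs : ∀ l, MDiffAt (T% ((trivializationAt E (TangentSpace I) x₀).localFrame b l)) p :=
    mdifferentiableAt_localFrame_chart b hp
  rw [PseudoRiemannianMetric.two_mul_val_leviCivita_apply_holds (g := g) (hs i) (hs j) (hs k)]
  simp only [PseudoRiemannianMetric.koszulFunctional, mlieBracket_localFrame_trivializationAt b hp,
    map_zero, sub_zero, add_zero]
  -- the metric coefficients as functions on `M` and their chart representatives
  have hgram : ∀ a c, MDifferentiableAt I 𝓘(ℝ, ℝ)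
      (fun y ↦ g.val y ((trivializationAt E (TangentSpace I) x₀).localFrame b a y)
        ((trivializationAt E (TangentSpace I) x₀).localFrame b c y)) p := by
    intro a c
    exact ((contMDiffOn_gram_localFrame (trivializationAt E (TangentSpace I) x₀) g b a c p
      hpe).contMDiffAt ((trivializationAt E (TangentSpace I) x₀).open_baseSet.mem_nhds
      hpe)).mdifferentiableAt (by simp)
  have hrep : ∀ a c, (fun z ↦ Gh z a c) =ᶠ[𝓝 (extChartAt I x₀ p)]
      (fun y ↦ g.val y ((trivializationAt E (TangentSpace I) x₀).localFrame b a y)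
        ((trivializationAt E (TangentSpace I) x₀).localFrame b c y)) ∘
        (extChartAt I x₀).symm := by
    intro a c
    filter_upwards [hGh] with z hz
    exact hz a c
  rw [mvfderiv_apply_localFrame_of_eventuallyEq b hp (hgram j k) (hrep j k) i,
    mvfderiv_apply_localFrame_of_eventuallyEq b hp (hgram k i) (hrep k i) j,
    mvfderiv_apply_localFrame_of_eventuallyEq b hp (hgram i j) (hrep i j) k]

end Koszul

/-! ### Chart representatives of a `C²` function and of its partial derivatives -/

section Rep

variable [I.Boundaryless] {ι : Type*} (b : Module.Basis ι ℝ E) {x₀ p : M} {f : M → ℝ} {fh : E → ℝ}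

omit [I.Boundaryless] in
/-- **A `C²` function is `C²` near the point** (`contMDiffAt_iff_contMDiffAt_nhds`), transported to
the chart: for `z` near `φ p`, `f` is `C²` at `φ⁻¹ z`. [folklore] -/
theorem eventually_contMDiffAt_symm (hp : p ∈ (chartAt H x₀).source) (hf : CMDiffAt 2 f p) :
    ∀ᶠ z in 𝓝 (extChartAt I x₀ p), CMDiffAt 2 f ((extChartAt I x₀).symm z) := by
  have hps : p ∈ (extChartAt I x₀).source := by simpa [extChartAt_source] using hp
  have hz : extChartAt I x₀ p ∈ (extChartAt I x₀).target := (extChartAt I x₀).map_source hps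
  have h1 : ∀ᶠ y in 𝓝 p, CMDiffAt 2 f y := (contMDiffAt_iff_contMDiffAt_nhds (by simp)).1 hf
  have hc : ContinuousAt (extChartAt I x₀).symm (extChartAt I x₀ p) :=
    continuousAt_extChartAt_symm'' hz
  have h2 : Tendsto (extChartAt I x₀).symm (𝓝 (extChartAt I x₀ p)) (𝓝 p) := by
    have := hc.tendsto
    rwa [(extChartAt I x₀).left_inv hps] at this
  exact h2.eventually h1

/-- **The chart representative of a `C²` function is `C²`**: if `fh` agrees with `f ∘ φ⁻¹` near
`φ p` and `f` is `C²` at `p`, then `fh` is `C²` at `φ p`. [folklore] -/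
theorem contDiffAt_rep (hp : p ∈ (chartAt H x₀).source) (hf : CMDiffAt 2 f p)
    (hfh : fh =ᶠ[𝓝 (extChartAt I x₀ p)] f ∘ (extChartAt I x₀).symm) :
    ContDiffAt ℝ 2 fh (extChartAt I x₀ p) := by
  have hps : p ∈ (extChartAt I x₀).source := by simpa [extChartAt_source] using hp
  have hz : extChartAt I x₀ p ∈ (extChartAt I x₀).target := (extChartAt I x₀).map_source hps
  have hsymm : ContMDiffAt 𝓘(ℝ, E) I 2 (extChartAt I x₀).symm (extChartAt I x₀ p) :=
    (contMDiffOn_extChartAt_symm x₀).contMDiffAt ((isOpen_extChartAt_target x₀).mem_nhds hz)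
  have hf' : CMDiffAt 2 f ((extChartAt I x₀).symm (extChartAt I x₀ p)) := by
    rwa [(extChartAt I x₀).left_inv hps]
  have hcomp : ContMDiffAt 𝓘(ℝ, E) 𝓘(ℝ, ℝ) 2 (f ∘ (extChartAt I x₀).symm) (extChartAt I x₀ p) :=
    hf'.comp _ hsymm
  exact (contMDiffAt_iff_contDiffAt.1 hcomp).congr_of_eventuallyEq hfh

/-- **The chart representative of `∂ⱼ f`.** For `f` of class `C²` at `p` with representative `fh`
near `φ p`: for `z` near `φ p`, `∂ⱼ fh (z) = df(∂ⱼ)(φ⁻¹ z)`, i.e. the function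
`y ↦ df_y(∂ⱼ|_y)` has representative `z ↦ D fh (z) bⱼ`. [cite: ONeill1983, Ch. 1, Def. 1.9 ff] -/
theorem eventually_fderiv_rep_eq (hp : p ∈ (chartAt H x₀).source) (hf : CMDiffAt 2 f p)
    (hfh : fh =ᶠ[𝓝 (extChartAt I x₀ p)] f ∘ (extChartAt I x₀).symm) (j : ι) :
    ∀ᶠ z in 𝓝 (extChartAt I x₀ p), fderiv ℝ fh z (b j) =
      mvfderiv I f ((extChartAt I x₀).symm z)
        ((trivializationAt E (TangentSpace I) x₀).localFrame b j ((extChartAt I x₀).symm z)) := by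
  have hps : p ∈ (extChartAt I x₀).source := by simpa [extChartAt_source] using hp
  have hz : extChartAt I x₀ p ∈ (extChartAt I x₀).target := (extChartAt I x₀).map_source hps
  have htarget : ∀ᶠ z in 𝓝 (extChartAt I x₀ p), z ∈ (extChartAt I x₀).target :=
    (isOpen_extChartAt_target x₀).mem_nhds hz
  filter_upwards [htarget, eventually_contMDiffAt_symm hp hf, hfh.eventually_nhds] with z hzt hfz hfhz
  have hzs : (extChartAt I x₀).symm z ∈ (chartAt H x₀).source := by
    rw [← extChartAt_source I]; exact (extChartAt I x₀).map_target hzt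
  have hfhz' : fh =ᶠ[𝓝 z] f ∘ (extChartAt I x₀).symm := hfhz
  rw [mvfderiv_apply_localFrame b hzs (hfz.mdifferentiableAt (by simp)) j,
    (extChartAt I x₀).right_inv hzt, hfhz'.fderiv_eq]

/-- **`y ↦ df_y(∂ⱼ|_y)` is differentiable at `p`** for `f` of class `C²` at `p` (its chart
representative `z ↦ D fh (z) bⱼ` is differentiable at `φ p`). [folklore] -/
theorem mdifferentiableAt_mvfderiv_localFrame (hp : p ∈ (chartAt H x₀).source)
    (hf : CMDiffAt 2 f p) (j : ι) :
    MDifferentiableAt I 𝓘(ℝ, ℝ) (fun y ↦ mvfderiv I f y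
      ((trivializationAt E (TangentSpace I) x₀).localFrame b j y)) p := by
  have hps : p ∈ (extChartAt I x₀).source := by simpa [extChartAt_source] using hp
  set fh : E → ℝ := f ∘ (extChartAt I x₀).symm with hfh_def
  have hfh : fh =ᶠ[𝓝 (extChartAt I x₀ p)] f ∘ (extChartAt I x₀).symm := Filter.EventuallyEq.rfl
  have hfh2 : ContDiffAt ℝ 2 fh (extChartAt I x₀ p) := contDiffAt_rep hp hf hfh
  -- the representative `z ↦ D fh z (b j)` is differentiable at `φ p`
  have hd : DifferentiableAt ℝ (fun z ↦ fderiv ℝ fh z (b j)) (extChartAt I x₀ p) :=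
    ((hfh2.fderiv_right (m := 1) le_rfl).differentiableAt (by simp)).clm_apply
      (differentiableAt_const _)
  have hd' : MDifferentiableAt 𝓘(ℝ, E) 𝓘(ℝ, ℝ) (fun z ↦ fderiv ℝ fh z (b j)) (extChartAt I x₀ p) :=
    mdifferentiableAt_iff_differentiableAt.2 hd
  have hcomp : MDifferentiableAt I 𝓘(ℝ, ℝ) ((fun z ↦ fderiv ℝ fh z (b j)) ∘ extChartAt I x₀) p :=
    hd'.comp p (mdifferentiableAt_extChartAt hp)
  refine hcomp.congr_of_eventuallyEq ?_
  -- near `p`, `df_y(∂ⱼ) = D fh (φ y) bⱼ`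
  have hev := eventually_fderiv_rep_eq b hp hf hfh j
  have hc : ContinuousAt (extChartAt I x₀) p := continuousAt_extChartAt' hps
  have hsrc : ∀ᶠ y in 𝓝 p, y ∈ (extChartAt I x₀).source :=
    (isOpen_extChartAt_source x₀).mem_nhds hps
  filter_upwards [hc.eventually hev, hsrc] with y hy hys
  simp only [Function.comp_apply]
  rw [hy, (extChartAt I x₀).left_inv hys]

end Rep

/-! ### The Hessian and the Laplace–Beltrami operator in the coordinate frame -/

section Hessian

variable [FiniteDimensional ℝ E] [CompleteSpace E] [I.Boundaryless]
  (g : PseudoRiemannianMetric I ∞ E (TangentSpace I : M → Type _)) [g.HasLeviCivita]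
  {ι : Type*} [Fintype ι] [DecidableEq ι] (b : Module.Basis ι ℝ E) {x₀ p : M}

/-- **The Hessian on coordinate vectors.** For `p` in the chart domain of `x₀`, `f` of class `C²`
at `p` with chart representative `fh` near `φ p`, and a representative `Gh` of the metric
coefficients `g(∂ᵢ, ∂ⱼ)` near `φ p`:
`Hess f (∂ᵢ, ∂ⱼ)(p) = ∂ᵢ∂ⱼ fh − ∑ₗ Γˡᵢⱼ ∂ₗ fh` at `φ p`, where
`Γˡᵢⱼ = ∑ₖ ½(∂ᵢ g_{jk} + ∂ⱼ g_{ki} − ∂ₖ g_{ij}) gᵏˡ` (O'Neill 1983, Ch. 3, Lemma 3.49 with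
Prop. 3.13: `H^f(∂ᵢ, ∂ⱼ) = ∂ᵢ∂ⱼ f − (D_{∂ᵢ}∂ⱼ) f`, `D_{∂ᵢ}∂ⱼ = Γᵏᵢⱼ ∂ₖ`; Lee 2018, (5.29)
`u_{;ij}`). Ingredients: `hessian_apply_holds` on the (differentiable) coordinate fields, the
Koszul formula `two_mul_val_leviCivita_localFrame`, the expansion of `∇_{∂ᵢ}∂ⱼ` in the frame
(`mvfderiv_apply_eq_sum_gram_inv`) and the chart representative of `y ↦ df_y(∂ⱼ)`
(`eventually_fderiv_rep_eq`). [cite: ONeill1983, Ch. 3, Lemma 3.49 and Prop. 3.13] -/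
theorem hessian_localFrame (hp : p ∈ (chartAt H x₀).source) {f : M → ℝ} (hf : CMDiffAt 2 f p)
    {Gh : E → ι → ι → ℝ}
    (hGh : ∀ᶠ z in 𝓝 (extChartAt I x₀ p), ∀ i j, Gh z i j =
      g.val ((extChartAt I x₀).symm z)
        ((trivializationAt E (TangentSpace I) x₀).localFrame b i ((extChartAt I x₀).symm z))
        ((trivializationAt E (TangentSpace I) x₀).localFrame b j ((extChartAt I x₀).symm z)))
    {fh : E → ℝ} (hfh : fh =ᶠ[𝓝 (extChartAt I x₀ p)] f ∘ (extChartAt I x₀).symm) (i j : ι) :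
    g.hessian f p ((trivializationAt E (TangentSpace I) x₀).localFrame b i p)
        ((trivializationAt E (TangentSpace I) x₀).localFrame b j p) =
      fderiv ℝ (fderiv ℝ fh) (extChartAt I x₀ p) (b i) (b j) -
        ∑ l, (∑ k, 2⁻¹ * (fderiv ℝ (fun z ↦ Gh z j k) (extChartAt I x₀ p) (b i) +
            fderiv ℝ (fun z ↦ Gh z k i) (extChartAt I x₀ p) (b j) -
            fderiv ℝ (fun z ↦ Gh z i j) (extChartAt I x₀ p) (b k)) *
          (Matrix.of fun i j ↦ g.val p ((trivializationAt E (TangentSpace I) x₀).localFrame b i p)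
            ((trivializationAt E (TangentSpace I) x₀).localFrame b j p))⁻¹ k l) *
          fderiv ℝ fh (extChartAt I x₀ p) (b l) := by
  have hs : ∀ l, MDiffAt (T% ((trivializationAt E (TangentSpace I) x₀).localFrame b l)) p :=
    mdifferentiableAt_localFrame_chart b hp
  rw [PseudoRiemannianMetric.hessian_apply_holds (g := g) hf (hs i) (hs j)]
  simp only [PseudoRiemannianMetric.hessianAux]
  -- the first-order term `(∇_{∂ᵢ} ∂ⱼ) f`
  have h2 : mvfderiv I f p (g.leviCivita ((trivializationAt E (TangentSpace I) x₀).localFrame b j) p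
      ((trivializationAt E (TangentSpace I) x₀).localFrame b i p)) =
      ∑ l, (∑ k, 2⁻¹ * (fderiv ℝ (fun z ↦ Gh z j k) (extChartAt I x₀ p) (b i) +
            fderiv ℝ (fun z ↦ Gh z k i) (extChartAt I x₀ p) (b j) -
            fderiv ℝ (fun z ↦ Gh z i j) (extChartAt I x₀ p) (b k)) *
          (Matrix.of fun i j ↦ g.val p ((trivializationAt E (TangentSpace I) x₀).localFrame b i p)
            ((trivializationAt E (TangentSpace I) x₀).localFrame b j p))⁻¹ k l) *
          fderiv ℝ fh (extChartAt I x₀ p) (b l) := by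
    rw [mvfderiv_apply_eq_sum_gram_inv g b hp f]
    refine Finset.sum_congr rfl (fun l _ ↦ ?_)
    rw [mvfderiv_apply_localFrame_of_eventuallyEq b hp (hf.mdifferentiableAt (by simp)) hfh l]
    congr 1
    refine Finset.sum_congr rfl (fun k _ ↦ ?_)
    congr 1
    have hK := two_mul_val_leviCivita_localFrame g b hp hGh i j k
    linarith
  -- the second-order term `∂ᵢ(∂ⱼ f)`
  have h1 : mvfderiv I (fun y ↦ mvfderiv I f y
      ((trivializationAt E (TangentSpace I) x₀).localFrame b j y)) p
      ((trivializationAt E (TangentSpace I) x₀).localFrame b i p) =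
      fderiv ℝ (fderiv ℝ fh) (extChartAt I x₀ p) (b i) (b j) := by
    have hrep : (fun z ↦ fderiv ℝ fh z (b j)) =ᶠ[𝓝 (extChartAt I x₀ p)]
        (fun y ↦ mvfderiv I f y ((trivializationAt E (TangentSpace I) x₀).localFrame b j y)) ∘
          (extChartAt I x₀).symm := by
      filter_upwards [eventually_fderiv_rep_eq b hp hf hfh j] with z hz
      exact hz
    rw [mvfderiv_apply_localFrame_of_eventuallyEq b hp
      (mdifferentiableAt_mvfderiv_localFrame b hp hf j) hrep i]
    have hfh2 := contDiffAt_rep hp hf hfh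
    have hd : DifferentiableAt ℝ (fderiv ℝ fh) (extChartAt I x₀ p) :=
      (hfh2.fderiv_right (m := 1) le_rfl).differentiableAt (by simp)
    have hD : HasFDerivAt (fun z ↦ fderiv ℝ fh z (b j))
        ((ContinuousLinearMap.apply ℝ ℝ (b j)).comp (fderiv ℝ (fderiv ℝ fh) (extChartAt I x₀ p)))
        (extChartAt I x₀ p) :=
      (ContinuousLinearMap.apply ℝ ℝ (b j)).hasFDerivAt.comp (extChartAt I x₀ p) hd.hasFDerivAt
    rw [hD.fderiv]
    rfl
  rw [h1, h2]

/-- **The Laplace–Beltrami operator in a chart.** For a smooth pseudo-Riemannian metric `g` on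
`M`, a point `p` of the chart domain of `x₀` (`φ = extChartAt I x₀`, coordinate frame `∂ᵢ` for a
basis `b` of the model space), `f` of class `C²` at `p` with chart representative `fh` near `φ p`
(`fh = f ∘ φ⁻¹` near `φ p`) and a representative `Gh` of the metric coefficients
(`Gh z i j = g(∂ᵢ, ∂ⱼ)(φ⁻¹ z)` near `φ p`):
`□_g f (p) = ∑ᵢⱼ gⁱʲ (∂ᵢ∂ⱼ fh − ∑ₗ (∑ₖ ½(∂ᵢg_{jk} + ∂ⱼg_{ik} − ∂ₖg_{ij}) gᵏˡ) ∂ₗ fh)` at `φ p`,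
with `(gⁱʲ) = (Gh(φ p))⁻¹` — the classical coordinate formula
`Δf = gⁱʲ(∂ᵢ∂ⱼ f − Γᵏᵢⱼ ∂ₖ f)` (O'Neill 1983, Ch. 3, the display following Def. 3.50, with
Prop. 3.13 for `Γ`; Lee 2018, (5.29) `Δu = gⁱʲ u_{;ij}`). From `hessian_localFrame` and the
metric trace in the coordinate basis (`trace_eq_sum_gram_inv`).
[cite: ONeill1983, Ch. 3, Def. 3.50 ff. and Prop. 3.13] -/
theorem dalembertian_eq_sum_localFrame (hp : p ∈ (chartAt H x₀).source) {f : M → ℝ}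
    (hf : CMDiffAt 2 f p) {Gh : E → ι → ι → ℝ}
    (hGh : ∀ᶠ z in 𝓝 (extChartAt I x₀ p), ∀ i j, Gh z i j =
      g.val ((extChartAt I x₀).symm z)
        ((trivializationAt E (TangentSpace I) x₀).localFrame b i ((extChartAt I x₀).symm z))
        ((trivializationAt E (TangentSpace I) x₀).localFrame b j ((extChartAt I x₀).symm z)))
    {fh : E → ℝ} (hfh : fh =ᶠ[𝓝 (extChartAt I x₀ p)] f ∘ (extChartAt I x₀).symm) :
    g.dalembertian f p =
      ∑ i, ∑ j, (Matrix.of (Gh (extChartAt I x₀ p)))⁻¹ i j *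
        (fderiv ℝ (fderiv ℝ fh) (extChartAt I x₀ p) (b i) (b j) -
          ∑ l, (∑ k, 2⁻¹ * (fderiv ℝ (fun z ↦ Gh z j k) (extChartAt I x₀ p) (b i) +
              fderiv ℝ (fun z ↦ Gh z i k) (extChartAt I x₀ p) (b j) -
              fderiv ℝ (fun z ↦ Gh z i j) (extChartAt I x₀ p) (b k)) *
            (Matrix.of (Gh (extChartAt I x₀ p)))⁻¹ k l) *
            fderiv ℝ fh (extChartAt I x₀ p) (b l)) := by
  have hps : p ∈ (extChartAt I x₀).source := by simpa [extChartAt_source] using hp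
  have hpe : p ∈ (trivializationAt E (TangentSpace I) x₀).baseSet := by simpa using hp
  -- the coordinate basis of `T_p M`
  set β : Module.Basis ι ℝ (TangentSpace I p) :=
    (trivializationAt E (TangentSpace I) x₀).basisAt b hpe with hβ_def
  have hβ : ∀ l, (trivializationAt E (TangentSpace I) x₀).localFrame b l p = β l := fun l ↦
    Trivialization.localFrame_apply_of_mem_baseSet _ b hpe
  -- the Gram matrix at `p` is `Gh (φ p)`, a symmetric matrix
  have hG0 : ∀ i j, Gh (extChartAt I x₀ p) i j =
      g.val p ((trivializationAt E (TangentSpace I) x₀).localFrame b i p)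
        ((trivializationAt E (TangentSpace I) x₀).localFrame b j p) := by
    intro i j
    have h := hGh.self_of_nhds i j
    rwa [(extChartAt I x₀).left_inv hps] at h
  have h𝒢 : (Matrix.of fun i j ↦ g.val p ((trivializationAt E (TangentSpace I) x₀).localFrame b i p)
      ((trivializationAt E (TangentSpace I) x₀).localFrame b j p)) =
      Matrix.of (Gh (extChartAt I x₀ p)) := by
    ext i j
    simp only [Matrix.of_apply, hG0]
  have hGs : (Matrix.of (Gh (extChartAt I x₀ p))).IsSymm :=
    Matrix.IsSymm.ext fun i j ↦ by simp only [Matrix.of_apply, hG0, g.symm p]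
  -- the derivatives `∂ⱼ g_{ki} = ∂ⱼ g_{ik}` (symmetry near `φ p`)
  have hsymd : ∀ i k v, fderiv ℝ (fun z ↦ Gh z k i) (extChartAt I x₀ p) v =
      fderiv ℝ (fun z ↦ Gh z i k) (extChartAt I x₀ p) v := by
    intro i k v
    have hev : (fun z ↦ Gh z k i) =ᶠ[𝓝 (extChartAt I x₀ p)] fun z ↦ Gh z i k := by
      filter_upwards [hGh] with z hz
      rw [hz k i, hz i k, g.symm]
    rw [hev.fderiv_eq]
  -- the trace in the coordinate basis
  rw [PseudoRiemannianMetric.dalembertian, trace_eq_sum_gram_inv g p β (g.hessian f p)]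
  simp only [← hβ]
  rw [h𝒢]
  refine Finset.sum_congr rfl (fun i _ ↦ Finset.sum_congr rfl (fun j _ ↦ ?_))
  rw [hGs.inv.apply i j, hessian_localFrame g b hp hf hGh hfh i j, h𝒢]
  simp only [hsymd]

end Hessian

/-! ### The inverse metric on differentials in the coordinate frame -/

section InnerDual

variable [FiniteDimensional ℝ E] {n : ℕ∞ω}
  (g : PseudoRiemannianMetric I n E (TangentSpace I : M → Type _))
  {ι : Type*} [Fintype ι] [DecidableEq ι] (b : Module.Basis ι ℝ E) {x₀ p : M}

/-- **The inverse metric on covectors in the coordinate frame**: for covectors `α, β` at a point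
`p` of the chart domain of `x₀`, `g⁻¹_p(α, β) = ∑ᵢⱼ gⁱʲ α(∂ᵢ) β(∂ⱼ)` with `(gⁱʲ)` the inverse
Gram matrix of the coordinate frame (`♯β = ∑ₗ (∑ₖ β(∂ₖ) gᵏˡ) ∂ₗ` by
`eq_sum_gram_inv_smul_localFrame` and `g(♯β, ∂ₖ) = β(∂ₖ)`). O'Neill 1983, Ch. 3, p. 60
(`g^{ij}` is the inverse matrix; metrically equivalent covectors). [cite: ONeill1983, Ch. 3, p. 60] -/
theorem innerDual_eq_sum_localFrame (hp : p ∈ (chartAt H x₀).source)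
    (α β : Module.Dual ℝ (TangentSpace I p)) :
    g.innerDual p α β = ∑ l, ∑ k,
      (Matrix.of fun i j ↦ g.val p ((trivializationAt E (TangentSpace I) x₀).localFrame b i p)
        ((trivializationAt E (TangentSpace I) x₀).localFrame b j p))⁻¹ k l *
      β ((trivializationAt E (TangentSpace I) x₀).localFrame b k p) *
      α ((trivializationAt E (TangentSpace I) x₀).localFrame b l p) := by
  rw [PseudoRiemannianMetric.innerDual]
  conv_lhs => rw [eq_sum_gram_inv_smul_localFrame g b hp (g.sharp p β)]
  simp only [map_sum, map_smul, smul_eq_mul, g.val_sharp_apply, Finset.sum_mul]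
  refine Finset.sum_congr rfl (fun l _ ↦ Finset.sum_congr rfl (fun k _ ↦ ?_))
  ring

variable [I.Boundaryless]

/-- **`g⁻¹(du, dv)` in a chart.** For `u, v : M → ℝ` differentiable at a point `p` of the chart
domain of `x₀`, with chart representatives `uh, vh` near `φ p`:
`g⁻¹_p(du_p, dv_p) = ∑ᵢⱼ gⁱʲ(p) ∂ᵢuh(φ p) ∂ⱼvh(φ p)` — the coordinate expression
`⟨grad u, grad v⟩ = gⁱʲ ∂ᵢu ∂ⱼv` (Lee 2018, (2.14) ff. `grad f = gⁱʲ ∂ᵢf ∂ⱼ`; O'Neill 1983, Ch. 3,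
p. 60 and Def. 3.50 (gradient)). [cite: ONeill1983, Ch. 3, p. 60 and Def. 3.50] -/
theorem innerDual_mvfderiv_eq_sum_localFrame (hp : p ∈ (chartAt H x₀).source) {u v : M → ℝ}
    (hu : MDifferentiableAt I 𝓘(ℝ, ℝ) u p) (hv : MDifferentiableAt I 𝓘(ℝ, ℝ) v p)
    {uh vh : E → ℝ} (huh : uh =ᶠ[𝓝 (extChartAt I x₀ p)] u ∘ (extChartAt I x₀).symm)
    (hvh : vh =ᶠ[𝓝 (extChartAt I x₀ p)] v ∘ (extChartAt I x₀).symm) :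
    g.innerDual p (mvfderiv I u p).toLinearMap (mvfderiv I v p).toLinearMap =
      ∑ i, ∑ j, (Matrix.of fun i j ↦ g.val p
          ((trivializationAt E (TangentSpace I) x₀).localFrame b i p)
          ((trivializationAt E (TangentSpace I) x₀).localFrame b j p))⁻¹ i j *
        fderiv ℝ uh (extChartAt I x₀ p) (b i) * fderiv ℝ vh (extChartAt I x₀ p) (b j) := by
  rw [innerDual_eq_sum_localFrame g b hp]
  refine Finset.sum_congr rfl (fun i _ ↦ Finset.sum_congr rfl (fun j _ ↦ ?_))
  rw [ContinuousLinearMap.coe_coe, ContinuousLinearMap.coe_coe,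
    mvfderiv_apply_localFrame_of_eventuallyEq b hp hv hvh j,
    mvfderiv_apply_localFrame_of_eventuallyEq b hp hu huh i]
  -- symmetry of the inverse Gram matrix
  have hGs : (Matrix.of fun i j ↦ g.val p
      ((trivializationAt E (TangentSpace I) x₀).localFrame b i p)
      ((trivializationAt E (TangentSpace I) x₀).localFrame b j p)).IsSymm :=
    Matrix.IsSymm.ext fun i j ↦ by simp only [Matrix.of_apply, g.symm p]
  rw [hGs.inv.apply i j]
  ring

end InnerDual

/-! ### Regularity of the chart representatives; continuity of `□_g f` and of `g⁻¹(du, dv)` -/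

section Continuity

variable [I.Boundaryless] {x₀ : M}

omit [IsManifold I ∞ M] [I.Boundaryless] in
/-- **Chart representatives of `C^k` functions are `C^k` on the chart target** (composition with
the smooth inverse chart). [folklore] -/
theorem contDiffOn_comp_extChartAt_symm {F : M → ℝ} {k : ℕ∞ω} [IsManifold I k M]
    (hF : CMDiff k F) :
    ContDiffOn ℝ k (F ∘ (extChartAt I x₀).symm) (extChartAt I x₀).target := by
  rw [← contMDiffOn_iff_contDiffOn]
  exact hF.comp_contMDiffOn (contMDiffOn_extChartAt_symm x₀)

variable {ι : Type*} (b : Module.Basis ι ℝ E)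
  (g : PseudoRiemannianMetric I ∞ E (TangentSpace I : M → Type _))

omit [I.Boundaryless] in
/-- **The metric coefficients in a chart are `C^∞` on the chart target**: for a smooth metric,
`y ↦ g(∂ᵢ, ∂ⱼ)(φ⁻¹ y)` is `C^∞` on `φ.target` (`contMDiffOn_gram_localFrame` composed with the
smooth inverse chart). Lee 2018, Ch. 2 (the `g_{ij}` are smooth functions). [folklore] -/
theorem contDiffOn_gram_comp_extChartAt_symm (i j : ι) :
    ContDiffOn ℝ ∞ (fun y ↦ g.val ((extChartAt I x₀).symm y)
      ((trivializationAt E (TangentSpace I) x₀).localFrame b i ((extChartAt I x₀).symm y))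
      ((trivializationAt E (TangentSpace I) x₀).localFrame b j ((extChartAt I x₀).symm y)))
      (extChartAt I x₀).target := by
  rw [← contMDiffOn_iff_contDiffOn]
  have hmaps : MapsTo (extChartAt I x₀).symm (extChartAt I x₀).target
      (trivializationAt E (TangentSpace I) x₀).baseSet := by
    intro y hy
    rw [TangentBundle.trivializationAt_baseSet, ← extChartAt_source I]
    exact (extChartAt I x₀).map_target hy
  exact (contMDiffOn_gram_localFrame (trivializationAt E (TangentSpace I) x₀) g b i j).comp
    (contMDiffOn_extChartAt_symm x₀) hmaps

variable [Fintype ι] [DecidableEq ι]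

omit [I.Boundaryless] in
/-- The Gram matrix of the coordinate frame, read in the chart, is invertible on the chart target.
[folklore] -/
theorem det_gram_comp_extChartAt_symm_ne_zero {y : E} (hy : y ∈ (extChartAt I x₀).target) :
    (Matrix.of fun i j ↦ g.val ((extChartAt I x₀).symm y)
      ((trivializationAt E (TangentSpace I) x₀).localFrame b i ((extChartAt I x₀).symm y))
      ((trivializationAt E (TangentSpace I) x₀).localFrame b j ((extChartAt I x₀).symm y))).det
      ≠ 0 := by
  refine det_gram_localFrame_ne_zero (trivializationAt E (TangentSpace I) x₀) g b ?_
  rw [TangentBundle.trivializationAt_baseSet, ← extChartAt_source I]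
  exact (extChartAt I x₀).map_target hy

/-- **The coordinate expression of `□_g f` is continuous on the chart target** for `f ∈ C²(M)`:
with `Ĝ(y)ᵢⱼ = g(∂ᵢ,∂ⱼ)(φ⁻¹y)` and `f̂ = f ∘ φ⁻¹`, the function
`y ↦ ∑ᵢⱼ Ĝ⁻¹ᵢⱼ (∂ᵢ∂ⱼ f̂ − ∑ₗ (∑ₖ ½(∂ᵢĜ_{jk} + ∂ⱼĜ_{ik} − ∂ₖĜ_{ij}) Ĝ⁻¹ₖₗ) ∂ₗ f̂)` is continuous on
`φ.target` (smooth `Ĝ`, continuous second derivatives of `f̂`). [folklore] -/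
theorem continuousOn_coordLaplacian {f : M → ℝ} (hf : CMDiff 2 f) :
    ContinuousOn (fun y ↦ ∑ i, ∑ j,
      (Matrix.of fun i j ↦ g.val ((extChartAt I x₀).symm y)
        ((trivializationAt E (TangentSpace I) x₀).localFrame b i ((extChartAt I x₀).symm y))
        ((trivializationAt E (TangentSpace I) x₀).localFrame b j ((extChartAt I x₀).symm y)))⁻¹ i j *
      (fderiv ℝ (fderiv ℝ (f ∘ (extChartAt I x₀).symm)) y (b i) (b j) -
        ∑ l, (∑ k, 2⁻¹ *
          (fderiv ℝ (fun z ↦ g.val ((extChartAt I x₀).symm z)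
              ((trivializationAt E (TangentSpace I) x₀).localFrame b j ((extChartAt I x₀).symm z))
              ((trivializationAt E (TangentSpace I) x₀).localFrame b k ((extChartAt I x₀).symm z)))
              y (b i) +
            fderiv ℝ (fun z ↦ g.val ((extChartAt I x₀).symm z)
              ((trivializationAt E (TangentSpace I) x₀).localFrame b i ((extChartAt I x₀).symm z))
              ((trivializationAt E (TangentSpace I) x₀).localFrame b k ((extChartAt I x₀).symm z)))
              y (b j) -
            fderiv ℝ (fun z ↦ g.val ((extChartAt I x₀).symm z)
              ((trivializationAt E (TangentSpace I) x₀).localFrame b i ((extChartAt I x₀).symm z))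
              ((trivializationAt E (TangentSpace I) x₀).localFrame b j ((extChartAt I x₀).symm z)))
              y (b k)) *
          (Matrix.of fun i j ↦ g.val ((extChartAt I x₀).symm y)
            ((trivializationAt E (TangentSpace I) x₀).localFrame b i ((extChartAt I x₀).symm y))
            ((trivializationAt E (TangentSpace I) x₀).localFrame b j
              ((extChartAt I x₀).symm y)))⁻¹ k l) *
          fderiv ℝ (f ∘ (extChartAt I x₀).symm) y (b l)))
      (extChartAt I x₀).target := by
  have hT : IsOpen (extChartAt I x₀).target := isOpen_extChartAt_target x₀
  -- the ingredients are continuous on the target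
  have hG : ∀ i j, ContDiffOn ℝ ∞ (fun y ↦ g.val ((extChartAt I x₀).symm y)
      ((trivializationAt E (TangentSpace I) x₀).localFrame b i ((extChartAt I x₀).symm y))
      ((trivializationAt E (TangentSpace I) x₀).localFrame b j ((extChartAt I x₀).symm y)))
      (extChartAt I x₀).target := contDiffOn_gram_comp_extChartAt_symm b g
  have hGinv : ∀ i j, ContinuousOn (fun y ↦ (Matrix.of fun i j ↦ g.val ((extChartAt I x₀).symm y)
      ((trivializationAt E (TangentSpace I) x₀).localFrame b i ((extChartAt I x₀).symm y))
      ((trivializationAt E (TangentSpace I) x₀).localFrame b j ((extChartAt I x₀).symm y)))⁻¹ i j)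
      (extChartAt I x₀).target := by
    intro i j y hy
    have h := contMDiffAt_matrix_inv (I := 𝓘(ℝ, E)) (k := ∞)
      (A := fun y ↦ Matrix.of fun i j ↦ g.val ((extChartAt I x₀).symm y)
        ((trivializationAt E (TangentSpace I) x₀).localFrame b i ((extChartAt I x₀).symm y))
        ((trivializationAt E (TangentSpace I) x₀).localFrame b j ((extChartAt I x₀).symm y)))
      (x₀ := y) (fun i j ↦ contMDiffAt_iff_contDiffAt.2 ((hG i j).contDiffAt (hT.mem_nhds hy)))
      (det_gram_comp_extChartAt_symm_ne_zero b g hy) i j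
    exact (contMDiffAt_iff_contDiffAt.1 h).continuousAt.continuousWithinAt
  have hdG : ∀ i j (v : E), ContinuousOn (fun y ↦ fderiv ℝ (fun z ↦ g.val ((extChartAt I x₀).symm z)
      ((trivializationAt E (TangentSpace I) x₀).localFrame b i ((extChartAt I x₀).symm z))
      ((trivializationAt E (TangentSpace I) x₀).localFrame b j ((extChartAt I x₀).symm z))) y v)
      (extChartAt I x₀).target := fun i j v ↦
    (((hG i j).continuousOn_fderiv_of_isOpen hT (by simp)).clm_apply continuousOn_const)
  have hfh : ContDiffOn ℝ 2 (f ∘ (extChartAt I x₀).symm) (extChartAt I x₀).target :=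
    contDiffOn_comp_extChartAt_symm hf
  have hdf : ∀ v : E, ContinuousOn (fun y ↦ fderiv ℝ (f ∘ (extChartAt I x₀).symm) y v)
      (extChartAt I x₀).target := fun v ↦
    (hfh.continuousOn_fderiv_of_isOpen hT (by norm_num)).clm_apply continuousOn_const
  have hd2f : ∀ v w : E, ContinuousOn
      (fun y ↦ fderiv ℝ (fderiv ℝ (f ∘ (extChartAt I x₀).symm)) y v w) (extChartAt I x₀).target := by
    intro v w
    have h1 : ContDiffOn ℝ 1 (fderiv ℝ (f ∘ (extChartAt I x₀).symm)) (extChartAt I x₀).target :=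
      hfh.fderiv_of_isOpen hT (by norm_num)
    exact ((h1.continuousOn_fderiv_of_isOpen hT le_rfl).clm_apply continuousOn_const).clm_apply
      continuousOn_const
  -- assemble
  refine continuousOn_finsetSum _ (fun i _ ↦ continuousOn_finsetSum _ (fun j _ ↦ ?_))
  refine (hGinv i j).mul ((hd2f (b i) (b j)).sub ?_)
  refine continuousOn_finsetSum _ (fun l _ ↦ ?_)
  refine (continuousOn_finsetSum _ (fun k _ ↦ ?_)).mul (hdf (b l))
  exact (continuousOn_const.mul (((hdG j k (b i)).add (hdG i k (b j))).sub (hdG i j (b k)))).mul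
    (hGinv k l)

variable [FiniteDimensional ℝ E] [CompleteSpace E] [g.HasLeviCivita]

/-- **The Laplace–Beltrami operator of a `C²` function is continuous** (for a smooth metric): on
each chart domain `□_g f` is the continuous coordinate expression of `continuousOn_coordLaplacian`
composed with the chart (`dalembertian_eq_sum_localFrame`). O'Neill 1983, Ch. 3, Def. 3.50 ff.
(`Δf ∈ 𝔉(M)`). [cite: ONeill1983, Ch. 3, Def. 3.50 ff.] -/
theorem continuous_dalembertian {f : M → ℝ} (hf : CMDiff 2 f) : Continuous (g.dalembertian f) := by
  classical
  refine continuous_iff_continuousAt.2 (fun x₀ ↦ ?_)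
  obtain ⟨b⟩ : Nonempty (Module.Basis (Fin (Module.finrank ℝ E)) ℝ E) := ⟨Module.finBasis ℝ E⟩
  have hps : x₀ ∈ (extChartAt I x₀).source := mem_extChartAt_source x₀
  have hz : extChartAt I x₀ x₀ ∈ (extChartAt I x₀).target := (extChartAt I x₀).map_source hps
  have hsrc : ∀ᶠ p in 𝓝 x₀, p ∈ (chartAt H x₀).source := (chartAt H x₀).open_source.mem_nhds
    (mem_chart_source H x₀)
  have hc := ((continuousOn_coordLaplacian (x₀ := x₀) b g hf).continuousAt
    ((isOpen_extChartAt_target x₀).mem_nhds hz)).comp (continuousAt_extChartAt x₀)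
  refine hc.congr ?_
  filter_upwards [hsrc] with p hp
  exact (dalembertian_eq_sum_localFrame g b hp (hf p) (Eventually.of_forall fun z i j ↦ rfl)
    Filter.EventuallyEq.rfl).symm

omit [FiniteDimensional ℝ E] [CompleteSpace E] [g.HasLeviCivita] in
/-- **The coordinate expression of `g⁻¹(du, dv)` is continuous on the chart target** for
`u, v ∈ C¹(M)`: `y ↦ ∑ᵢⱼ Ĝ⁻¹ᵢⱼ ∂ᵢû ∂ⱼv̂` with `û = u ∘ φ⁻¹`, `v̂ = v ∘ φ⁻¹`. [folklore] -/
theorem continuousOn_coordInnerDual {u v : M → ℝ} (hu : CMDiff 1 u) (hv : CMDiff 1 v) :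
    ContinuousOn (fun y ↦ ∑ i, ∑ j,
      (Matrix.of fun i j ↦ g.val ((extChartAt I x₀).symm y)
        ((trivializationAt E (TangentSpace I) x₀).localFrame b i ((extChartAt I x₀).symm y))
        ((trivializationAt E (TangentSpace I) x₀).localFrame b j ((extChartAt I x₀).symm y)))⁻¹ i j *
      fderiv ℝ (u ∘ (extChartAt I x₀).symm) y (b i) * fderiv ℝ (v ∘ (extChartAt I x₀).symm) y (b j))
      (extChartAt I x₀).target := by
  have hT : IsOpen (extChartAt I x₀).target := isOpen_extChartAt_target x₀
  have hG : ∀ i j, ContDiffOn ℝ ∞ (fun y ↦ g.val ((extChartAt I x₀).symm y)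
      ((trivializationAt E (TangentSpace I) x₀).localFrame b i ((extChartAt I x₀).symm y))
      ((trivializationAt E (TangentSpace I) x₀).localFrame b j ((extChartAt I x₀).symm y)))
      (extChartAt I x₀).target := contDiffOn_gram_comp_extChartAt_symm b g
  have hGinv : ∀ i j, ContinuousOn (fun y ↦ (Matrix.of fun i j ↦ g.val ((extChartAt I x₀).symm y)
      ((trivializationAt E (TangentSpace I) x₀).localFrame b i ((extChartAt I x₀).symm y))
      ((trivializationAt E (TangentSpace I) x₀).localFrame b j ((extChartAt I x₀).symm y)))⁻¹ i j)
      (extChartAt I x₀).target := by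
    intro i j y hy
    have h := contMDiffAt_matrix_inv (I := 𝓘(ℝ, E)) (k := ∞)
      (A := fun y ↦ Matrix.of fun i j ↦ g.val ((extChartAt I x₀).symm y)
        ((trivializationAt E (TangentSpace I) x₀).localFrame b i ((extChartAt I x₀).symm y))
        ((trivializationAt E (TangentSpace I) x₀).localFrame b j ((extChartAt I x₀).symm y)))
      (x₀ := y) (fun i j ↦ contMDiffAt_iff_contDiffAt.2 ((hG i j).contDiffAt (hT.mem_nhds hy)))
      (det_gram_comp_extChartAt_symm_ne_zero b g hy) i j
    exact (contMDiffAt_iff_contDiffAt.1 h).continuousAt.continuousWithinAt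
  have hd : ∀ {w : M → ℝ}, CMDiff 1 w → ∀ v : E,
      ContinuousOn (fun y ↦ fderiv ℝ (w ∘ (extChartAt I x₀).symm) y v) (extChartAt I x₀).target :=
    fun hw v ↦ ((contDiffOn_comp_extChartAt_symm hw).continuousOn_fderiv_of_isOpen hT
      le_rfl).clm_apply continuousOn_const
  refine continuousOn_finsetSum _ (fun i _ ↦ continuousOn_finsetSum _ (fun j _ ↦ ?_))
  exact ((hGinv i j).mul (hd hu (b i))).mul (hd hv (b j))

omit [CompleteSpace E] [g.HasLeviCivita] in
/-- **`g⁻¹(du, dv)` is continuous** for `u, v ∈ C¹(M)`: on each chart domain it is the continuous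
coordinate expression of `continuousOn_coordInnerDual` composed with the chart
(`innerDual_mvfderiv_eq_sum_localFrame`). O'Neill 1983, Ch. 3, p. 60 and Def. 3.50 (the
gradient is a smooth field). [folklore] -/
theorem continuous_innerDual_mvfderiv {u v : M → ℝ} (hu : CMDiff 1 u) (hv : CMDiff 1 v) :
    Continuous (fun p ↦ g.innerDual p (mvfderiv I u p).toLinearMap (mvfderiv I v p).toLinearMap) := by
  classical
  refine continuous_iff_continuousAt.2 (fun x₀ ↦ ?_)
  obtain ⟨b⟩ : Nonempty (Module.Basis (Fin (Module.finrank ℝ E)) ℝ E) := ⟨Module.finBasis ℝ E⟩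
  have hps : x₀ ∈ (extChartAt I x₀).source := mem_extChartAt_source x₀
  have hz : extChartAt I x₀ x₀ ∈ (extChartAt I x₀).target := (extChartAt I x₀).map_source hps
  have hsrc : ∀ᶠ p in 𝓝 x₀, p ∈ (chartAt H x₀).source := (chartAt H x₀).open_source.mem_nhds
    (mem_chart_source H x₀)
  have hc := ((continuousOn_coordInnerDual (x₀ := x₀) b g hu hv).continuousAt
    ((isOpen_extChartAt_target x₀).mem_nhds hz)).comp (continuousAt_extChartAt x₀)
  refine hc.congr ?_
  filter_upwards [hsrc] with p hp
  have hps' : p ∈ (extChartAt I x₀).source := by simpa [extChartAt_source] using hp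
  rw [Function.comp_apply, (extChartAt I x₀).left_inv hps']
  exact (innerDual_mvfderiv_eq_sum_localFrame g b hp ((hu p).mdifferentiableAt one_ne_zero)
    ((hv p).mdifferentiableAt one_ne_zero) Filter.EventuallyEq.rfl Filter.EventuallyEq.rfl).symm

end Continuity

end Literature.Geometry.Lorentzian

end
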